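import Summits.Ventures.Crystal3D.Theorems.StickyWulffConstantTextureBuildEnergyAssembly
import HarnessLib

/-!
# TB-1: the LABELLED POLYHEDRAL MESH v7 = v6 + OWNER NORMALS (Δ7, ruling (ccxxxvi)) — the SIXTH AND LAST binder form of `stub_TB_cover` / `stub_TB_energy`
# (lane T, crux `TextureLiminfV5`, stmt-Ventures-23912; memos HOME/wulff-p2/g21/TB-D-4-g21.md, B6-DESIGN-g21.md; ruling (ccxxxvi) conditions (C1)–(C3))

HONEST FRAMING. Venture `Summits/Ventures/Crystal3D` (cell `crystal3d-full`), route `route-Ventures-StickyWulffConstant`, helper `--supports` the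
law-v5 crux `TextureLiminfV5` (stmt-Ventures-23912).  DEFINITIONS (interface v7 = v6 + ONE `Prop` field; the riser-package debt `RiserPackage₇`) + the
energy assembly and the level-2 composition re-typed over v7 (pure logic; census-free, standard axioms).  No mesh is constructed, no riser package is
proved; F-C1 not moved.

WHY v7 (Δ7, B6-DESIGN-g21.md §3).  The riser package pays its CURTAINS (vertical walls inside riser box `r`, in-plane w.r.t. the box normal `rn r`) out of
`riserSum = Σ_{r′} ½·Σ_{b ∈ rown r′} #(rV r′ b ∖ X′)`, and `Mesh₃.hBV` makes `rV r′ b` the in-plane neighbour sites of `b` w.r.t. the OWNER's normal `rn r′`.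
`Mesh₅.hBown₅ / hBhalo` only say that the owner of a ball in / near box `r` is a piece of the same column-grain PAIR; nothing ties `rn r′` to `rn r`.  Δ7 does:
* `Mesh₇ extends Mesh₆` with **`hBownRn`** — a riser piece owning a ball in `closure (B r)`, or a ball of the pair's stackings within `1` of `B r`, has
  normal `± rn r`.  Constructor cost (C3): nil for every column-grain pair with ONE coherent plane family (every pair containing a non-fcc grain, and fcc
  pairs related by a one-family-coherent shift): the cover builds one frame `(L₀, s₀)` per pair and uses `rn := L₀ e₃` for all its pieces and boxes; for an
  fcc-translate pair coherent in two families the cover must keep family-2 owners out of the `1`-halo of family-1 boxes (boxes avoid riser-line crossings) —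
  a cover-side design note, no further mesh field (B6-DESIGN-g21.md §3).
* `RiserPackage₇`, `exists_good₇`, `tb_energy_of_riserPackage₇` (the energy half over `Mesh₇` = 5 lines on …EnergyAssembly's mesh-agnostic `tb_energy_of_good`),
  `shadowTheoremSatAtomicV5_of_risered₇R_slack`, `textureBuildR₇R_of_stubs` (the consumer glue, same shape as the ₆ ones).

(C1) CLOSED-LIST CERTIFICATE — what the proof of `RiserPackage₇` (B6, construction of B6-DESIGN-g21.md §1: per box the riser frame `(L₀,s₀,σL,σR)` chosen from
`hframe`, f-claimed = hexagon prisms `G_c` of OCCUPIED `rtL`-sites of RISER layers over TB-D-1's governing ranges, default `rtR`, `extra` = their data) CONSUMES,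
per field of `TexInput.Good` (…EnergyAssembly):
* `hR₀`, `hτ`, `hcut` — `Mesh₄.exists_good_cut` ✓ (…CutInput: `hpres₁/₂`, `hPZ`, `hex`, `hPbd/hPunit`; landed), exactly as in `exists_good`.
* `hbox : BoxRow` — cover fields: `hframe` (Mesh₃), `hBmatch₅` (Mesh₅: matched grain, `CompleteAt`, outside-material list), `desB ⊆ HB` via `desSet/desOf₂`
  (…Designated/…ContactEngine), `hBbd/hBunit`, the disjointness fields `hBD/hBP/hBQ/hBB/hQD/hQP/hQQ/hDD/hDP/hPP` and `hCD/hU` (only through the LANDED grain lemmas of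
  …ContactClasses/…ContactRows/…ExposedEngine), `hPlat/hwrap₁/₂/hside₀/₁/₂` (only through the landed `grain_eq_of_prism_not_prism` / `grain_eq_of_territory_prism`),
  `hBclean` (balls in a closed box lie on the two column stackings); cover fields: `X′_sep` (packing), `rtL/rtR/hrt`, `rn/hrn`, `tent`, `S`; landed pure lemmas:
  the contact engine (flipped cell, `antip_mem_of_contact_of_subset`, containers, `subset_of_mem_closure`), `piece_cases`, the frame agreement, bilayer (patch)
  rigidity; NEW pure lemmas (no cover input): (L-ax) «two layerings ⇒ axes parallel or affine fcc» (…GenericWallFloorFramePropagation `hcpType_of_shell_transfer`,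
  `exists_affine_fcc_of_const`) giving `SharedAxis (rn r)` for the two column grains' class frames, hexagon-prism `H`-polytope plumbing, «complete ⇒ tiled by the
  hexagons of occupied sites» (Voronoi property of the triangular layer), the slab dictionary (…FrameAgreement).
* `hcurtain : curtainSpecialSum ≤ riserSum` — cover fields: `hBown₅`, `hBhalo` (Mesh₅), `hBV` (Mesh₃), **`hBownRn` (Mesh₇)**, `hframe`, `hBbd`; cover fields
  `rown/hrown/hRR`, `rV`, `riserSum/riserBudget` (…RiserLine/…RiseredCover), `X′_sep`; landed pure lemmas: `lawW_le`/`lawC_le` (cost per ordered pair ≤ 13/50),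
  `sum_facetArea_inter_le_of_sameSide` (…CoplanarFacets), `facetArea_eq_zero_of_subset_two_planes` (same-grain vertical contacts are null), `facetArea_neg`;
  NEW pure lemmas: the area of a wall rectangle (`1/√3 × |V(m)| ≤ 2hB/√3`; `(13/25)·2hB/√3 < ½`).
«No B6 lemma uses anything about the cover beyond `Mesh₇`» — by (C2) any further cover property found while typing B6 is NOT a mesh field but a separate
registered stub `stub_coverProperty : ∀ … (μ : Mesh₇ rc δ), P μ` owned by whoever needs it; `stub_TB_cover` is never re-typed again.
-/

noncomputable section

open scoped BigOperators InnerProductSpace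
open MeasureTheory

namespace Summit.Ventures.Crystal3D.Cruxes.TextureLiminf.TexShadow

open Summit.Ventures.Crystal3D Summit.Ventures.Crystal3D.Theorems

/-- **The labelled polyhedral mesh, v7**: `Mesh₆` + owner normals (Δ7). -/
structure Mesh₇ {C R₀ : ℝ} {N : ℕ} {x : Fin N → E3} (rc : RiseredCover C R₀ N x) (δ : ℝ) extends Mesh₆ rc δ where
  /-- (Δ7) OWNER NORMALS: a riser piece owning a configuration ball in the closed box `r`, or a ball of the pair's two column stackings within distance `1` of
  the box, has the box's layer normal up to sign (so that its in-plane site sets `rV` are in-plane for the box). -/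
  hBownRn : ∀ r r', ∀ q ∈ rc.X', q ∈ rc.rown r' →
    (q ∈ closure (polytope (HB r)) ∨ ((q ∈ rc.S (rc.rtL r) ∨ q ∈ rc.S (rc.rtR r)) ∧ Metric.infDist q (polytope (HB r)) < 1)) →
    rc.rn r' = rc.rn r ∨ rc.rn r' = -rc.rn r

namespace Mesh₇

variable {C R₀ : ℝ} {N : ℕ} {x : Fin N → E3} {rc : RiseredCover C R₀ N x} {δ : ℝ}

/-- the gap cost (inherited) -/
def gapCost (μ : Mesh₇ rc δ) : ℝ := μ.toMesh₆.gapCost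

/-- `gapCost` is that of the underlying v3 mesh. -/
theorem gapCost_eq (μ : Mesh₇ rc δ) : μ.gapCost = μ.toMesh₃.gapCost := rfl

/-- `gapCost` is that of the underlying v6 mesh. -/
theorem gapCost_eq₆ (μ : Mesh₇ rc δ) : μ.gapCost = μ.toMesh₆.gapCost := rfl

end Mesh₇

/-! ## The riser package over v7 and the energy half -/

/-- **THE RISER PACKAGE over `Mesh₇` (B6, the registered debt of `stub_TB_energy` after T0)**: for every risered cover and v7 mesh, every certified tents and
cut levels in `(0,1)` (regime `1 ≤ R₀`), SOME riser planes and claim rule make the texture input's riser-box contact row `BoxRow` true and its curtain specials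
cost at most `riserSum` (…Specials; construction and proof plan: B6-DESIGN-g21.md). -/
def RiserPackage₇ : Prop :=
  ∀ {C R₀ : ℝ} {N : ℕ} {x : Fin N → E3} (rc : RiseredCover C R₀ N x) {δ : ℝ} (μ : Mesh₇ rc δ)
    (ct : (f : Fin rc.ng) → TentCert (rc.tent f)) (τ : Fin rc.nk → ℝ), 1 ≤ R₀ → (∀ k, τ k ∈ Set.Ioo (0 : ℝ) 1) →
    ∃ (extra : Finset (E3 × ℝ)) (hextra : ∀ p ∈ extra, ‖p.1‖ = 1) (boxGrain : Fin rc.nr → Finset (E3 × ℝ) → Fin rc.ng),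
      (TexInput.mk ct τ extra hextra boxGrain : TexInput rc μ.toMesh₅).BoxRow ∧
        (TexInput.mk ct τ extra hextra boxGrain : TexInput rc μ.toMesh₅).curtainSpecialSum ≤ rc.riserSum

/-- **A GOOD INPUT EXISTS over v7** given T0 and the riser package. -/
theorem exists_good₇ (hT0 : BarlowFreeCertificateCover) (hB6 : RiserPackage₇) {C R₀ : ℝ} (hR₀ : 1 ≤ R₀) {N : ℕ} {x : Fin N → E3}
    (rc : RiseredCover C R₀ N x) {δ : ℝ} (μ : Mesh₇ rc δ) : ∃ I : TexInput rc μ.toMesh₅, I.Good := by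
  classical
  set ct : (f : Fin rc.ng) → TentCert (rc.tent f) := fun f => tentCert hT0 (rc.tent f) with hct
  set τ : Fin rc.nk → ℝ := fun k => Classical.choose (μ.toMesh₄.exists_good_cut hR₀ k) with hτdef
  have hτ : ∀ k, τ k ∈ Set.Ioo (0 : ℝ) 1 := fun k => (Classical.choose_spec (μ.toMesh₄.exists_good_cut hR₀ k)).1
  obtain ⟨extra, hextra, boxGrain, hbox, hcurtain⟩ := hB6 rc μ ct τ hR₀ hτ
  refine ⟨TexInput.mk ct τ extra hextra boxGrain, ?_⟩
  exact
    { hR₀ := hR₀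
      hτ := hτ
      hcut := fun k F => (Classical.choose_spec (μ.toMesh₄.exists_good_cut hR₀ k)).2 F
      hbox := hbox
      hcurtain := hcurtain }

/-- **`stub_TB_energy` OVER v7 FROM T0 AND THE RISER PACKAGE** (the `henergy` binder of `shadowTheoremSatAtomicV5_of_risered₇R_slack`). -/
theorem tb_energy_of_riserPackage₇ (hT0 : BarlowFreeCertificateCover) (hB6 : RiserPackage₇) :
    PolytopeCalculus → BarlowFreeCertificate →
      ∀ (C R₀ : ℝ), 1 ≤ R₀ → ∀ (N : ℕ) (x : Fin N → E3) (δ : ℝ) (rc : RiseredCover C R₀ N x) (μ : Mesh₇ rc δ),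
        ∃ (n : ℕ) (G : Fin n → Set E3) (A : Fin n → (E3 ≃ₗᵢ[ℝ] E3)) (c : Fin n → Fin n → ℝ) (m : Fin n → Fin n → E3),
          IsTexture (13 / 25) (1 / 2) n G A c m ∧ (1 - δ) * (N : ℝ) ≤ Real.sqrt 2 * vol n G ∧
          energy n G A c m ≤ rc.tentBudget + rc.chargeSum + rc.riserSum + μ.gapCost :=
  fun _ _ _ _ hR₀ _ _ _ rc μ => tb_energy_of_good rc μ.toMesh₆ (exists_good₇ hT0 hB6 hR₀ rc μ)

/-! ## The level-2 composition of record (mesh v7, slack form, regime `1 ≤ R₀`) -/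

/-- **THE LEVEL-2 COMPOSITION over risered cover + mesh v7, WITH SLACK, regime `1 ≤ R₀`** (adhesion hypothesis arbitrary): «TB-cover v7» + «TB-energy v7» +
the wall law ⇒ the atomic-scale saturated shadow theorem. -/
theorem shadowTheoremSatAtomicV5_of_risered₇R_slack {Adh : Prop}
    (hcover : BarlowResolution → Adh →
      ∀ C R₀ : ℝ, 1 ≤ R₀ → ∀ K δ θ : ℝ, 0 < δ → 0 < θ → ∃ N₀ : ℕ, ∀ N : ℕ, N₀ ≤ N → ∀ x : Fin N → E3, IsUnitPacking x →
        IsSaturated x → 6 * (N : ℝ) - (numContacts x : ℝ) ≤ K * (N : ℝ) ^ ((2 : ℝ) / 3) →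
        ∃ (rc : RiseredCover C R₀ N x) (μ : Mesh₇ rc δ),
          rc.tilingLoss₂ + rc.rimSum + μ.gapCost ≤ θ * (N : ℝ) ^ ((2 : ℝ) / 3) + rc.unownedSlack₃)
    (henergy : PolytopeCalculus → BarlowFreeCertificate →
      ∀ (C R₀ : ℝ), 1 ≤ R₀ → ∀ (N : ℕ) (x : Fin N → E3) (δ : ℝ) (rc : RiseredCover C R₀ N x) (μ : Mesh₇ rc δ),
        ∃ (n : ℕ) (G : Fin n → Set E3) (A : Fin n → (E3 ≃ₗᵢ[ℝ] E3)) (c : Fin n → Fin n → ℝ) (m : Fin n → Fin n → E3),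
          IsTexture (13 / 25) (1 / 2) n G A c m ∧ (1 - δ) * (N : ℝ) ≤ Real.sqrt 2 * vol n G ∧
          energy n G A c m ≤ rc.tentBudget + rc.chargeSum + rc.riserSum + μ.gapCost) :
    BarlowResolution → Adh → BilayerWallV5 → PolytopeCalculus → BarlowFreeCertificate → ShadowTheoremSatAtomicV5 := by
  intro hres hadh hBW hpoly hfree _hG _hC _hNRG _hSL K δ θ hδ hθ
  obtain ⟨C, R₀, hR₀, hW⟩ := hBW
  obtain ⟨N₀, hN₀⟩ := hcover hres hadh C R₀ hR₀ K δ θ hδ hθ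
  refine ⟨N₀, fun N hN x hx hsat hK => ?_⟩
  obtain ⟨rc, μ, hslack⟩ := hN₀ N hN x hx hsat hK
  obtain ⟨n, G, A, c, m, hT, hvol, hEn⟩ := henergy hpoly hfree C R₀ hR₀ N x δ rc μ
  refine ⟨n, G, A, c, m, hT, hvol, ?_⟩
  have hdisc := rc.tentBudget_add_chargeSum_le₃_slack hR₀ hW
  linarith

/-- **THE COMPOSITION OF RECORD (mesh v7, regime `1 ≤ R₀`)**: TB-cover v7 + TB-energy v7 ⇒ the registered shape of `stub_textureBuild`. -/
theorem textureBuildR₇R_of_stubs {Adh : Prop}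
    (hcover : BarlowResolution → Adh →
      ∀ C R₀ : ℝ, 1 ≤ R₀ → ∀ K δ θ : ℝ, 0 < δ → 0 < θ → ∃ N₀ : ℕ, ∀ N : ℕ, N₀ ≤ N → ∀ x : Fin N → E3, IsUnitPacking x →
        IsSaturated x → 6 * (N : ℝ) - (numContacts x : ℝ) ≤ K * (N : ℝ) ^ ((2 : ℝ) / 3) →
        ∃ (rc : RiseredCover C R₀ N x) (μ : Mesh₇ rc δ),
          rc.tilingLoss₂ + rc.rimSum + μ.gapCost ≤ θ * (N : ℝ) ^ ((2 : ℝ) / 3) + rc.unownedSlack₃)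
    (henergy : PolytopeCalculus → BarlowFreeCertificate →
      ∀ (C R₀ : ℝ), 1 ≤ R₀ → ∀ (N : ℕ) (x : Fin N → E3) (δ : ℝ) (rc : RiseredCover C R₀ N x) (μ : Mesh₇ rc δ),
        ∃ (n : ℕ) (G : Fin n → Set E3) (A : Fin n → (E3 ≃ₗᵢ[ℝ] E3)) (c : Fin n → Fin n → ℝ) (m : Fin n → Fin n → E3),
          IsTexture (13 / 25) (1 / 2) n G A c m ∧ (1 - δ) * (N : ℝ) ≤ Real.sqrt 2 * vol n G ∧
          energy n G A c m ≤ rc.tentBudget + rc.chargeSum + rc.riserSum + μ.gapCost) :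
    BarlowResolution → Adh → BilayerWallV5 → PolytopeCalculus → BarlowFreeCertificate → ShadowTheoremSatV5 :=
  textureBuild_of_atomic (shadowTheoremSatAtomicV5_of_risered₇R_slack hcover henergy)

/-- **THE TB SUB-LINE BY NAME over v7**: TB-cover v7 + T0 + the riser package ⇒ `ShadowTheoremSatV5` (given the three line-level hypotheses). -/
theorem textureBuildR₇R_of_riserPackage {Adh : Prop}
    (hcover : BarlowResolution → Adh →
      ∀ C R₀ : ℝ, 1 ≤ R₀ → ∀ K δ θ : ℝ, 0 < δ → 0 < θ → ∃ N₀ : ℕ, ∀ N : ℕ, N₀ ≤ N → ∀ x : Fin N → E3, IsUnitPacking x →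
        IsSaturated x → 6 * (N : ℝ) - (numContacts x : ℝ) ≤ K * (N : ℝ) ^ ((2 : ℝ) / 3) →
        ∃ (rc : RiseredCover C R₀ N x) (μ : Mesh₇ rc δ),
          rc.tilingLoss₂ + rc.rimSum + μ.gapCost ≤ θ * (N : ℝ) ^ ((2 : ℝ) / 3) + rc.unownedSlack₃)
    (hT0 : BarlowFreeCertificateCover) (hB6 : RiserPackage₇) :
    BarlowResolution → Adh → BilayerWallV5 → PolytopeCalculus → BarlowFreeCertificate → ShadowTheoremSatV5 :=
  textureBuildR₇R_of_stubs hcover (tb_energy_of_riserPackage₇ hT0 hB6)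

end Summit.Ventures.Crystal3D.Cruxes.TextureLiminf.TexShadow

end
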